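import Mathlib
import Summits.NavierStokesRegularity.NavierStokesRegularity.Theorems.EulerZoomLiouvillePowerGaugeEulerLiouvilleSelfSimilarPastProfilePressure
import Summits.NavierStokesRegularity.NavierStokesRegularity.Theorems.EulerZoomLiouvillePowerGaugeEulerLiouvilleKillingRotation
import HarnessLib

/-!
# Crux `EulerZoomLiouville.PowerGaugeEulerLiouville` (stmt-NavierStokesRegularity-19832), line `relative_equilibria` (ns-idea-11), R3a PORT RECIPE
# brick P4 (growth half): the `D`-GAUGE OF A SPIRAL (Perelman-ansatz) MEMBER IN PROFILE VARIABLES at large scales — (D₁)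

Route №10 `EulerZoomLiouville` (NavierStokesRegularity), crux E; width seat ns-sfl-p1 g11 under the LEAD ns-typeII-p2 (R3a recipe of
`Cruxes/PowerGaugeEulerLiouville/Lines/relative-equilibria.md`, brick P4 = spiral twin of `PressureSlaving.inClass_pastSelfSimilarPressure` +
`Past.profile_pressure_growth_of_gaugeD_past`; this file is the second, growth, half).

SPIRAL (rotated self-similar) pressure about `(T, x₀)` with skew generator `S` (`⟪Sx, y⟫ = −⟪x, Sy⟫`) and SCALAR profile `Q`, on the past
sub-slab `τ < T₁` (`T₁ ≤ 0`, `T₁ ≤ T`): `p(τ, x) = λ^{2(γ−1)} Q(e^{−(log λ)S} λ^{−γ}(x − x₀))`, `λ = T − τ` (the pressure clause that spiral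
pressure slaving produces; `S = 0` is the untwisted `selfSimilarCollapsePressure γ T Q τ (x − x₀)`).  KEY ALGEBRA (i) of the recipe: each slice is
the UNTWISTED slice of the ROTATED profile `Q ∘ e^{−(log λ)S}`, and origin-centred ball integrals of `|Q ∘ R|^{3/2}` equal those of `|Q|^{3/2}`
(`Killing.setLIntegral_ball_comp_expSkew`), so the untwisted brick `Past.profile_pressure_growth_of_gaugeD_past` ports slice by slice:

* `Spiral.pressureSlice_eq_rotated` — the spiral pressure slice at `τ` is the untwisted slice of `Q ∘ e^{−(log λ)S}`;
* ★ `Spiral.profile_pressure_growth_of_gaugeD_pastSpiral` — THE BRICK (D₁): `a^{2ρ} D(a; 0; p) ≤ c` (all `a > 0`), `p` spiral about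
  `(T, x₀)` with profile `Q` for `τ < T₁`, `γ = 1/(2+ρ)`, `0 < ρ < 1` ⇒ for some `C < ∞`: `∫_{B_L} |Q|^{3/2} ≤ C L^{2−2ρ}` for every
  `L ≥ 2 − T₁` (window `τ ∈ (T₁ − 2, T₁ − 1)` of `Q_a(0,0)`, `a = (T − T₁ + 2)^{γ} L + ‖x₀‖`, Tonelli, the slice lemma
  `Past.lintegral_ball_enorm_rpow_shiftedPressure_ge` applied to the rotated profile, time weight `(T − τ)^{6γ−3} ≥ (T − T₁ + 2)^{6γ−3}`).

WHAT THIS IS NOT: not NS, not E, not a stub: one brick (P4, growth half) of the port R3a of a width sub-line (spiral = `O(3)`-twisted self-similar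
stratum of `stub_nonSelfSimilarRest`); 19832 OPEN; no summit statement is proved by this file. [folklore; ChaeTsai2013DSS p. 4 (Perelman's rotated
ansatz); CaffarelliKohnNirenberg1982 §2]
-/

noncomputable section

-- flat `Theorems/<Route><Decl>…` files of one crux share the namespace of the crux (tree convention: `Summit.<S>.<S>.…`)
set_option linter.dupNamespace false

open MeasureTheory Set Filter Topology Metric Function TopologicalSpace
open scoped ENNReal NNReal RealInnerProductSpace

namespace Summit.NavierStokesRegularity.NavierStokesRegularity.Theorems.PowerGaugeEulerLiouville

open Literature.Analysis Literature.Analysis.FunctionSpaces Literature.Analysis.FluidPDE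

namespace Spiral

variable {S : EuclideanSpace ℝ (Fin 3) →L[ℝ] EuclideanSpace ℝ (Fin 3)}

/-- **KEY ALGEBRA (i), pressure: the spiral pressure slice is the untwisted slice of the rotated profile.**
`λ^{2(γ−1)} Q(e^{−(log λ)S} λ^{−γ}(x − x₀)) = λ^{2(γ−1)} (Q ∘ e^{−(log λ)S})(λ^{−γ}(x − x₀))` (linearity of the rotation). [folklore] -/
theorem pressureSlice_eq_rotated {γ lam : ℝ} (x₀ : EuclideanSpace ℝ (Fin 3)) (Q : EuclideanSpace ℝ (Fin 3) → ℝ) :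
    (fun x : EuclideanSpace ℝ (Fin 3) => lam ^ (2 * (γ - 1)) *
        Q (NormedSpace.exp ((-Real.log lam) • S) (lam ^ (-γ) • (x - x₀)))) =
      fun x => lam ^ (2 * (γ - 1)) *
        (fun y => Q (NormedSpace.exp ((-Real.log lam) • S) y)) (lam ^ (-γ) • (x - x₀)) := by
  funext x
  simp only

/-- ★ **THE `D`-GAUGE OF A SPIRAL MEMBER IN PROFILE VARIABLES (large scales) — (D₁).**  Let `p` be a.e.-strongly measurable on the
slab `(−∞,0) × ℝ³` with `p(τ, x) = (T − τ)^{2(γ−1)} Q(e^{−(log(T−τ))S} (T − τ)^{−γ}(x − x₀))` for `τ < T₁` (`T₁ ≤ 0`, `T₁ ≤ T`,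
`γ = 1/(2+ρ)`, `0 < ρ < 1`, `S` skew), and suppose the power gauge `a^{2ρ} D(a; 0; p) ≤ c` for all `a > 0`.  Then for some `C < ∞`:
`∫_{B_L} |Q|^{3/2} ≤ C L^{2−2ρ}` for every `L ≥ 2 − T₁`.  Proof = the untwisted brick `Past.profile_pressure_growth_of_gaugeD_past` verbatim,
the slice lemma `Past.lintegral_ball_enorm_rpow_shiftedPressure_ge` applied on each slice of the window `(T₁ − 2, T₁ − 1)` to the ROTATED profile
`Q ∘ e^{−(log(T−τ))S}`, whose ball integrals are those of `Q` (`Killing.setLIntegral_ball_comp_expSkew`); `C = s₁^{3−6γ} (s₁^{γ} + ‖x₀‖)^{2−2ρ} c`,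
`s₁ = T − T₁ + 2`.  `S = 0` is the untwisted brick. [folklore; CaffarelliKohnNirenberg1982 §2] -/
theorem profile_pressure_growth_of_gaugeD_pastSpiral {ρ : ℝ} (hρ : 0 < ρ) (hρ1 : ρ < 1)
    {T T₁ : ℝ} (hT₁ : T₁ ≤ 0) (hTT₁ : T₁ ≤ T) (x₀ : EuclideanSpace ℝ (Fin 3))
    (hS : ∀ x y : EuclideanSpace ℝ (Fin 3), ⟪S x, y⟫ = -⟪x, S y⟫)
    {p : ℝ → EuclideanSpace ℝ (Fin 3) → ℝ} {Q : EuclideanSpace ℝ (Fin 3) → ℝ} {c : ℝ≥0}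
    (hpm : AEStronglyMeasurable (uncurry p)
      (volume.restrict (Iio (0 : ℝ) ×ˢ (univ : Set (EuclideanSpace ℝ (Fin 3))))))
    (hp : ∀ τ : ℝ, τ < T₁ → p τ = fun x => (T - τ) ^ (2 * (1 / (2 + ρ) - 1)) *
      Q (NormedSpace.exp ((-Real.log (T - τ)) • S) ((T - τ) ^ (-(1 / (2 + ρ))) • (x - x₀))))
    (hD : ∀ a : ℝ, 0 < a →
      ENNReal.ofReal (a ^ (2 * ρ)) * cknD a (0 : ℝ × EuclideanSpace ℝ (Fin 3)) p ≤ (c : ℝ≥0∞)) :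
    ∃ C : ℝ≥0∞, C ≠ ⊤ ∧ ∀ L : ℝ, 2 - T₁ ≤ L →
      ∫⁻ y in ball (0 : EuclideanSpace ℝ (Fin 3)) L, ‖Q y‖ₑ ^ (3 / 2 : ℝ) ≤
        C * ENNReal.ofReal (L ^ (2 - 2 * ρ)) := by
  -- adapted from `Past.profile_pressure_growth_of_gaugeD_past` (…SelfSimilarPastProfilePressure); only step (4) changes
  have hS0 : ∀ x : EuclideanSpace ℝ (Fin 3), ⟪S x, x⟫ = 0 := fun x => by
    have h := hS x x
    rw [real_inner_comm (S x) x] at h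
    linarith
  set γ : ℝ := 1 / (2 + ρ) with hγ
  have h2ρ : 0 < 2 + ρ := by linarith
  have hγ0 : 0 < γ := by rw [hγ]; positivity
  have hγ63 : 6 * γ - 3 ≤ 0 := by
    have : γ ≤ 1 / 2 := by
      rw [hγ, div_le_div_iff₀ h2ρ two_pos]; linarith
    linarith
  have h2ρ' : 0 ≤ 2 - 2 * ρ := by linarith
  -- the time scale `s₁ = T − T₁ + 2` of the window `(T₁ − 2, T₁ − 1)` and the constant
  set s₁ : ℝ := T - T₁ + 2 with hs₁
  have hS2 : 2 ≤ s₁ := by rw [hs₁]; linarith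
  have hs₁0 : 0 < s₁ := by linarith
  set σ : ℝ := s₁ ^ γ with hσ
  have hσ0 : 0 < σ := Real.rpow_pos_of_pos hs₁0 _
  have hσ1 : 1 ≤ σ := Real.one_le_rpow (by linarith) hγ0.le
  set k : ℝ := s₁ ^ (3 - 6 * γ) * (σ + ‖x₀‖) ^ (2 - 2 * ρ) with hk
  refine ⟨ENNReal.ofReal k * (c : ℝ≥0∞), ENNReal.mul_ne_top ENNReal.ofReal_ne_top ENNReal.coe_ne_top,
    fun L hL => ?_⟩
  have hL2 : 2 ≤ L := by linarith
  have hL0 : 0 < L := by linarith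
  -- ### the radius `a = σ L + ‖x₀‖`
  set a : ℝ := σ * L + ‖x₀‖ with ha
  have haL : L ≤ a := by
    have : 1 * L ≤ σ * L := mul_le_mul_of_nonneg_right hσ1 hL0.le
    have := norm_nonneg x₀
    rw [ha]; linarith
  have ha0 : 0 < a := by linarith
  -- ### (1) the gauge: `X = ∫∫_{Q_a} |p|^{3/2} ≤ a^{2−2ρ} c`
  set X : ℝ≥0∞ := ∫⁻ q in parabolicCylinder a (0 : ℝ × EuclideanSpace ℝ (Fin 3)),
    ‖p q.1 q.2‖ₑ ^ (3 / 2 : ℝ) with hX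
  have hXle : X ≤ ENNReal.ofReal (a ^ (2 - 2 * ρ)) * (c : ℝ≥0∞) := by
    have h1 := hD a ha0
    unfold cknD at h1
    have hA0 : ENNReal.ofReal a ^ 2 ≠ 0 := pow_ne_zero _ (by rw [ENNReal.ofReal_ne_zero_iff]; exact ha0)
    have hAtop : ENNReal.ofReal a ^ 2 ≠ ⊤ := ENNReal.pow_ne_top ENNReal.ofReal_ne_top
    have hB0 : ENNReal.ofReal (a ^ (2 * ρ)) ≠ 0 := by
      rw [ENNReal.ofReal_ne_zero_iff]; exact Real.rpow_pos_of_pos ha0 _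
    have key : X = ENNReal.ofReal a ^ 2 * (ENNReal.ofReal (a ^ (2 * ρ)))⁻¹ *
        (ENNReal.ofReal (a ^ (2 * ρ)) * ((ENNReal.ofReal a ^ 2)⁻¹ * X)) := by
      rw [← mul_assoc, mul_assoc (ENNReal.ofReal a ^ 2), ENNReal.inv_mul_cancel hB0 ENNReal.ofReal_ne_top,
        mul_one, ← mul_assoc, ENNReal.mul_inv_cancel hA0 hAtop, one_mul]
    calc X = _ := key
      _ ≤ ENNReal.ofReal a ^ 2 * (ENNReal.ofReal (a ^ (2 * ρ)))⁻¹ * (c : ℝ≥0∞) := by gcongr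
      _ = ENNReal.ofReal (a ^ (2 - 2 * ρ)) * (c : ℝ≥0∞) := by
          rw [← ENNReal.ofReal_inv_of_pos (Real.rpow_pos_of_pos ha0 _), ← ENNReal.ofReal_pow ha0.le,
            ← ENNReal.ofReal_mul (by positivity)]
          congr 2
          rw [Real.rpow_sub ha0, Real.rpow_two, div_eq_mul_inv]
  -- ### (2) the window `(T₁ − 2, T₁ − 1) × B_a` inside `Q_a(0,0)`
  have hWsub : Ioo (T₁ - 2) (T₁ - 1) ×ˢ ball (0 : EuclideanSpace ℝ (Fin 3)) a ⊆
      parabolicCylinder a (0 : ℝ × EuclideanSpace ℝ (Fin 3)) := by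
    intro q hq
    rw [mem_prod, mem_Ioo, mem_ball] at hq
    rw [mem_parabolicCylinder, Prod.fst_zero, Prod.snd_zero, zero_sub]
    have ha2 : 2 - T₁ ≤ a ^ 2 := by nlinarith
    exact ⟨⟨by linarith [hq.1.1], by linarith [hq.1.2]⟩, hq.2⟩
  have hY : ∫⁻ q in Ioo (T₁ - 2) (T₁ - 1) ×ˢ ball (0 : EuclideanSpace ℝ (Fin 3)) a,
      ‖p q.1 q.2‖ₑ ^ (3 / 2 : ℝ) ≤ X :=
    lintegral_mono_set hWsub
  -- ### (3) Tonelli on the window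
  have hpmW : AEMeasurable (fun q : ℝ × EuclideanSpace ℝ (Fin 3) => ‖p q.1 q.2‖ₑ ^ (3 / 2 : ℝ))
      (((volume : Measure ℝ).restrict (Ioo (T₁ - 2) (T₁ - 1))).prod
        ((volume : Measure (EuclideanSpace ℝ (Fin 3))).restrict (ball 0 a))) := by
    have hsub : Ioo (T₁ - 2) (T₁ - 1) ×ˢ ball (0 : EuclideanSpace ℝ (Fin 3)) a ⊆
        Iio (0 : ℝ) ×ˢ (univ : Set (EuclideanSpace ℝ (Fin 3))) :=
      prod_mono (fun t ht => by have := ht.2; rw [mem_Iio]; linarith) (subset_univ _)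
    have := (hpm.mono_measure (Measure.restrict_mono hsub le_rfl)).enorm.pow_const (3 / 2 : ℝ)
    rwa [Measure.volume_eq_prod, ← Measure.prod_restrict] at this
  have hYeq : ∫⁻ q in Ioo (T₁ - 2) (T₁ - 1) ×ˢ ball (0 : EuclideanSpace ℝ (Fin 3)) a,
        ‖p q.1 q.2‖ₑ ^ (3 / 2 : ℝ) =
      ∫⁻ τ in Ioo (T₁ - 2) (T₁ - 1), ∫⁻ x in ball (0 : EuclideanSpace ℝ (Fin 3)) a,
        ‖p τ x‖ₑ ^ (3 / 2 : ℝ) := by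
    rw [Measure.volume_eq_prod, ← Measure.prod_restrict, lintegral_prod _ hpmW]
  -- ### (4) the lower bound on the slices of the window — the rotated profile has the same ball integrals
  set J : ℝ≥0∞ := ∫⁻ y in ball (0 : EuclideanSpace ℝ (Fin 3)) L, ‖Q y‖ₑ ^ (3 / 2 : ℝ) with hJ
  have hlow : ∀ᵐ τ ∂((volume : Measure ℝ).restrict (Ioo (T₁ - 2) (T₁ - 1))),
      ENNReal.ofReal (s₁ ^ (6 * γ - 3)) * J ≤
        ∫⁻ x in ball (0 : EuclideanSpace ℝ (Fin 3)) a, ‖p τ x‖ₑ ^ (3 / 2 : ℝ) := by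
    filter_upwards [ae_restrict_mem measurableSet_Ioo] with τ hτW
    have hτ : τ < T₁ := by have := hτW.2; linarith
    have hs : 0 < T - τ := by linarith
    have hsS : T - τ ≤ s₁ := by have := hτW.1; rw [hs₁]; linarith
    -- the rotated profile on this slice
    set QR : EuclideanSpace ℝ (Fin 3) → ℝ := fun y => Q (NormedSpace.exp ((-Real.log (T - τ)) • S) y) with hQR
    have hpτ : (fun x => ‖p τ x‖ₑ ^ (3 / 2 : ℝ)) = fun x =>
        ‖(T - τ) ^ (2 * (γ - 1)) * QR ((T - τ) ^ (-γ) • (x - x₀))‖ₑ ^ (3 / 2 : ℝ) := by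
      funext x
      rw [hp τ hτ, hQR]
    have hJR : ∫⁻ y in ball (0 : EuclideanSpace ℝ (Fin 3)) L, ‖QR y‖ₑ ^ (3 / 2 : ℝ) = J := by
      rw [hQR, hJ]
      exact Killing.setLIntegral_ball_comp_expSkew hS0 (-Real.log (T - τ))
        (fun y => ‖Q y‖ₑ ^ (3 / 2 : ℝ)) L
    rw [hpτ, ← hJR]
    have hLa : (T - τ) ^ γ * L + ‖x₀‖ ≤ a := by
      have : (T - τ) ^ γ ≤ σ := Real.rpow_le_rpow hs.le hsS hγ0.le
      rw [ha]; nlinarith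
    calc ENNReal.ofReal (s₁ ^ (6 * γ - 3)) * ∫⁻ y in ball (0 : EuclideanSpace ℝ (Fin 3)) L, ‖QR y‖ₑ ^ (3 / 2 : ℝ)
        ≤ ENNReal.ofReal ((T - τ) ^ (6 * γ - 3)) * ∫⁻ y in ball (0 : EuclideanSpace ℝ (Fin 3)) L, ‖QR y‖ₑ ^ (3 / 2 : ℝ) :=
          mul_le_mul' (ENNReal.ofReal_le_ofReal (Real.rpow_le_rpow_of_nonpos hs hsS hγ63)) le_rfl
      _ ≤ _ := Past.lintegral_ball_enorm_rpow_shiftedPressure_ge γ hs x₀ QR hLa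
  -- ### (5) integrate the lower bound over the window (length `1`)
  have hvolW : volume (Ioo (T₁ - 2) (T₁ - 1)) = 1 := by
    rw [Real.volume_Ioo, show T₁ - 1 - (T₁ - 2) = (1 : ℝ) by ring, ENNReal.ofReal_one]
  have hJle : ENNReal.ofReal (s₁ ^ (6 * γ - 3)) * J ≤ X :=
    calc ENNReal.ofReal (s₁ ^ (6 * γ - 3)) * J
        = ∫⁻ _ in Ioo (T₁ - 2) (T₁ - 1), ENNReal.ofReal (s₁ ^ (6 * γ - 3)) * J := by
          rw [setLIntegral_const, hvolW, mul_one]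
      _ ≤ ∫⁻ τ in Ioo (T₁ - 2) (T₁ - 1), ∫⁻ x in ball (0 : EuclideanSpace ℝ (Fin 3)) a,
            ‖p τ x‖ₑ ^ (3 / 2 : ℝ) := lintegral_mono_ae hlow
      _ = _ := hYeq.symm
      _ ≤ X := hY
  -- ### (6) assemble
  have haL' : a ^ (2 - 2 * ρ) ≤ (σ + ‖x₀‖) ^ (2 - 2 * ρ) * L ^ (2 - 2 * ρ) := by
    rw [← Real.mul_rpow (by positivity) hL0.le]
    refine Real.rpow_le_rpow ha0.le ?_ h2ρ'
    have : ‖x₀‖ ≤ ‖x₀‖ * L := le_mul_of_one_le_right (norm_nonneg _) (by linarith)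
    rw [ha]; nlinarith
  have hunit : ENNReal.ofReal (s₁ ^ (3 - 6 * γ)) * ENNReal.ofReal (s₁ ^ (6 * γ - 3)) = 1 := by
    rw [← ENNReal.ofReal_mul (Real.rpow_nonneg hs₁0.le _), ← Real.rpow_add hs₁0,
      show (3 - 6 * γ) + (6 * γ - 3) = 0 by ring, Real.rpow_zero, ENNReal.ofReal_one]
  calc J = ENNReal.ofReal (s₁ ^ (3 - 6 * γ)) * (ENNReal.ofReal (s₁ ^ (6 * γ - 3)) * J) := by
        rw [← mul_assoc, hunit, one_mul]
    _ ≤ ENNReal.ofReal (s₁ ^ (3 - 6 * γ)) * X := by gcongr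
    _ ≤ ENNReal.ofReal (s₁ ^ (3 - 6 * γ)) * (ENNReal.ofReal (a ^ (2 - 2 * ρ)) * (c : ℝ≥0∞)) := by gcongr
    _ ≤ ENNReal.ofReal (s₁ ^ (3 - 6 * γ)) *
          (ENNReal.ofReal ((σ + ‖x₀‖) ^ (2 - 2 * ρ) * L ^ (2 - 2 * ρ)) * (c : ℝ≥0∞)) := by gcongr
    _ = ENNReal.ofReal k * (c : ℝ≥0∞) * ENNReal.ofReal (L ^ (2 - 2 * ρ)) := by
        rw [hk, ENNReal.ofReal_mul (by positivity), ENNReal.ofReal_mul (by positivity)]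
        ring

end Spiral

end Summit.NavierStokesRegularity.NavierStokesRegularity.Theorems.PowerGaugeEulerLiouville

end
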